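import Summits.ABC.ABC.Theorems.TwistAmplificationSharpModerateLawTwistMinimalDefs

/-!
# Crux `TwistAmplification.SharpModerateLaw` (stmt-ABC-1975): the twist-orbit inversion — scaling of the invariants

Lead `prover-line-stmt-ABC-1975-c6-0`, skeleton v5 (line `unit-plane-conic-two-torsion`, twist-orbit inversion of the
core), stub `stub_twistScaling : TwistScaling` (file `…TwistMinimalScaling.lean`).

For a squarefree `d ≥ 1` all of whose prime factors are `≥ 5` and prime to `w := u'³ − v'² ≠ 0`, with `1728 ∣ w`,
the twist `d ⋆ x' = (d²u', d³v')` (`twistPair`) of `x' = (u', v')` has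

* `Mcusp (d ⋆ x') = d⁶ · Mcusp x'` — write `w = 1728·Δ'`; the discriminant numerator of `d ⋆ x'` is `d⁶w`
  (`twistPair_cube_sub_sq`), so its `Δ` is `d⁶Δ'`, and `max(d⁶|Δ'|, (d²|u'|)³) = d⁶ · max(|Δ'|, |u'|³)`;
* `N5cusp (d ⋆ x') = d² · N5cusp x'` — the prime factors of `d⁶|Δ'|` are the DISJOINT union of those of `d` (all
  `≥ 5`, each dividing `d²u'`, hence charged `p²`; their product is `(∏ p)² = d²` because `d` is squarefree) and those
  of `|Δ'|` (none of which divides `d`, so `p ∣ d²u' ↔ p ∣ u'`: exactly the factors of `N5cusp x'`).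

* `prod_primeFactors_sq_of_squarefree` — `∏_{p ∣ d} p² = d²` for squarefree `d`;
* `stub_twistScaling` — the registered stub.
-/

noncomputable section

-- the mandated summit namespace `Summit.ABC.ABC` (summit = problem) trips the duplicate-namespace linter
set_option linter.dupNamespace false

namespace Summit.ABC.ABC.Theorems.SharpModerateLaw

/-- For a squarefree `d`, `∏_{p ∈ primeFactors d} p² = d²`. -/
theorem prod_primeFactors_sq_of_squarefree {d : ℕ} (hd : Squarefree d) :
    ∏ p ∈ d.primeFactors, p ^ 2 = d ^ 2 := by
  rw [Finset.prod_pow, Nat.prod_primeFactors_of_squarefree hd]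

/-- **`TwistScaling`** (registered stub of skeleton v5, line `unit-plane-conic-two-torsion`): for `d ≥ 1` squarefree
with every prime factor `≥ 5` and prime to `x'.1³ − x'.2² ≠ 0`, and `1728 ∣ x'.1³ − x'.2²`, the level and the conductor
proxy of the twist scale exactly: `Mcusp (d ⋆ x') = d⁶ · Mcusp x'`, `N5cusp (d ⋆ x') = d² · N5cusp x'`. -/
theorem stub_twistScaling : TwistScaling := by
  intro d x' hd hsf hpr hne h1728
  obtain ⟨Δ', hΔ'⟩ := h1728
  have hd0 : d ≠ 0 := by omega
  have hΔ'0 : Δ' ≠ 0 := by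
    intro h
    apply hne
    rw [← sub_eq_zero, hΔ', h, mul_zero]
  -- `Δ(x') = Δ'` and `Δ(d ⋆ x') = d⁶ Δ'`, exactly
  have hdiv : (x'.1 ^ 3 - x'.2 ^ 2) / 1728 = Δ' := by
    rw [hΔ']
    exact Int.mul_ediv_cancel_left _ (by norm_num)
  have hdiv' : ((twistPair (d : ℤ) x').1 ^ 3 - (twistPair (d : ℤ) x').2 ^ 2) / 1728 = (d : ℤ) ^ 6 * Δ' := by
    rw [twistPair_cube_sub_sq, hΔ', mul_left_comm]
    exact Int.mul_ediv_cancel_left _ (by norm_num)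
  have hfst : (twistPair (d : ℤ) x').1 = (d : ℤ) ^ 2 * x'.1 := rfl
  refine ⟨?_, ?_⟩
  · -- the level `M⁺ = max(|Δ|, |c₄|³)`
    unfold Mcusp
    rw [hdiv', hdiv, hfst, Int.natAbs_mul, Int.natAbs_mul, Int.natAbs_pow, Int.natAbs_pow, Int.natAbs_natCast]
    have e : (d ^ 2 * x'.1.natAbs) ^ 3 = d ^ 6 * x'.1.natAbs ^ 3 := by ring
    rw [e, Nat.mul_max_mul_left]
  · -- the conductor proxy `N5cusp`
    -- no prime of `d` divides `Δ'` (it would divide `x'.1³ − x'.2² = 1728 Δ'`)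
    have hndvd : ∀ p : ℕ, p.Prime → p ∣ Δ'.natAbs → ¬ p ∣ d := fun p hp hpΔ hpd =>
      (hpr p hp hpd).2 (by rw [hΔ']; exact dvd_mul_of_dvd_right (Int.ofNat_dvd_left.mpr hpΔ) _)
    have hdisj : Disjoint d.primeFactors Δ'.natAbs.primeFactors :=
      Finset.disjoint_left.mpr fun p hpd hpΔ =>
        hndvd p (Nat.prime_of_mem_primeFactors hpd) (Nat.dvd_of_mem_primeFactors hpΔ)
          (Nat.dvd_of_mem_primeFactors hpd)
    -- the `d`-part: every prime of `d` is `≥ 5` and is charged `p²`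
    have hdpart : ∏ p ∈ d.primeFactors with 5 ≤ p, (if ((p : ℕ) : ℤ) ∣ (d : ℤ) ^ 2 * x'.1 then p ^ 2 else p) =
        d ^ 2 := by
      rw [Finset.filter_true_of_mem fun p hp =>
        (hpr p (Nat.prime_of_mem_primeFactors hp) (Nat.dvd_of_mem_primeFactors hp)).1,
        ← prod_primeFactors_sq_of_squarefree hsf]
      refine Finset.prod_congr rfl fun p hp => ?_
      rw [if_pos]
      exact dvd_mul_of_dvd_left
        (dvd_pow (Int.natCast_dvd_natCast.mpr (Nat.dvd_of_mem_primeFactors hp)) two_ne_zero) _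
    -- the `Δ'`-part: a prime of `Δ'` does not divide `d`, so `p ∣ d²u' ↔ p ∣ u'`
    have hΔpart : ∏ p ∈ Δ'.natAbs.primeFactors with 5 ≤ p,
          (if ((p : ℕ) : ℤ) ∣ (d : ℤ) ^ 2 * x'.1 then p ^ 2 else p) =
        ∏ p ∈ Δ'.natAbs.primeFactors with 5 ≤ p, (if ((p : ℕ) : ℤ) ∣ x'.1 then p ^ 2 else p) := by
      refine Finset.prod_congr rfl fun p hp => ?_
      obtain ⟨hpF, -⟩ := Finset.mem_filter.mp hp
      have hpp : p.Prime := Nat.prime_of_mem_primeFactors hpF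
      have hpZ : Prime (p : ℤ) := Nat.prime_iff_prime_int.mp hpp
      have hpd : ¬ p ∣ d := hndvd p hpp (Nat.dvd_of_mem_primeFactors hpF)
      refine if_congr ⟨fun h => ?_, fun h => dvd_mul_of_dvd_right h _⟩ rfl rfl
      rcases hpZ.dvd_or_dvd h with h | h
      · exact absurd (Int.natCast_dvd_natCast.mp (hpZ.dvd_of_dvd_pow h)) hpd
      · exact h
    unfold N5cusp
    rw [hdiv', hdiv, hfst, Int.natAbs_mul, Int.natAbs_pow, Int.natAbs_natCast,
      Nat.primeFactors_mul (pow_ne_zero 6 hd0) (Int.natAbs_ne_zero.mpr hΔ'0), Nat.primeFactors_pow _ (by norm_num),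
      Finset.filter_union, Finset.prod_union (Finset.disjoint_filter_filter hdisj), hdpart, hΔpart]

end Summit.ABC.ABC.Theorems.SharpModerateLaw

end
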